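import Mathlib
import Literature.MathematicalPhysics.KineticTheory.HardSphereEulerLLN
import HarnessLib

/-!
# `StaticScoreResponse` (support item stmt-AtomisticToContinuum-12269): the finite-`n` score
# identity for the configurational canonical Gibbs measure

Differentiation under the integral sign for the configurational canonical hard-sphere weights
`posWeight a ε n x = 𝟙_{no overlap}(x) ∏ᵢ a(xᵢ)` (`HardSphereEulerProofs`) along a differentiable
path of activities `κ ↦ a κ`:

* `hasDerivAt_integral_mul_posWeight` — for bounded measurable `F`,
  `d/dκ ∫ F · posWeight(a_κ) = ∫ F · 𝟙_{no overlap} ∑ᵢ a'_κ(xᵢ) ∏_{j ≠ i} a_κ(xⱼ)`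
  (dominated convergence on the finite measure space `(𝕋³)ⁿ`);
* `hasDerivAt_integral_mul_posWeight'` — for positive activities the derivative is
  `∫ F · (∑ᵢ g_κ(xᵢ)) · posWeight(a_κ)` with the logarithmic derivative `g = a'/a` (the SCORE
  `∑ᵢ ∂_κ log a_κ(xᵢ)` of the canonical family);
* `hasDerivAt_integral_posGibbsMeasure` — the **score identity**
  `d/dκ E_{a_κ}[F] = E_{a_κ}[F S_κ] - E_{a_κ}[F] E_{a_κ}[S_κ]` (`= Cov_{a_κ}(S_κ, F)`) for the
  normalised measure `posGibbsMeasure (a κ) ε n`, `S_κ = ∑ᵢ g_κ(xᵢ)`, whenever the partition function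
  is positive.

Folklore (exponential families / likelihood-ratio sensitivity); no definitions, no named facts.
-/

noncomputable section

namespace Summit.AtomisticToContinuum.HydrodynamicLimit.Theorems

open Finset MeasureTheory Metric Set Filter Topology
  Literature.MathematicalPhysics.KineticTheory

variable {n : ℕ}

/-! ### Differentiation of `∫ F · posWeight(a_κ)` -/

/-- Pointwise derivative of the position weight along a path of activities: off the non-overlap
set it is constant, on it it is the product rule. [folklore] -/
theorem hasDerivAt_posWeight {a a' : ℝ → T3 → ℝ} {κ : ℝ} (ε : ℝ) (x : Fin n → T3)
    (hderiv : ∀ y, HasDerivAt (fun κ => a κ y) (a' κ y) κ) :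
    HasDerivAt (fun κ => posWeight (a κ) ε n x)
      ((posDomain ε n).indicator (fun x => ∑ i, a' κ (x i) * ∏ j ∈ univ.erase i, a κ (x j)) x) κ := by
  by_cases hx : x ∈ posDomain ε n
  · simp only [posWeight, Set.indicator_of_mem hx]
    have h := HasDerivAt.fun_finsetProd (u := (univ : Finset (Fin n))) (f := fun i κ => a κ (x i))
      (f' := fun i => a' κ (x i)) (x := κ) fun i _ => hderiv (x i)
    simp only [smul_eq_mul] at h
    refine h.congr_deriv (Finset.sum_congr rfl fun i _ => mul_comm _ _)
  · simp only [posWeight, Set.indicator_of_notMem hx]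
    exact hasDerivAt_const κ 0

/-- Bound on the derivative of the position weight: `|∑ᵢ a'(xᵢ) ∏_{j≠i} a(xⱼ)| ≤ n Cⁿ` if
`|a|, |a'| ≤ C`. [folklore] -/
theorem abs_sum_mul_prod_erase_le {a a' : T3 → ℝ} {C : ℝ} (hC : 0 ≤ C) (ha : ∀ y, |a y| ≤ C)
    (ha' : ∀ y, |a' y| ≤ C) (x : Fin n → T3) :
    |∑ i, a' (x i) * ∏ j ∈ univ.erase i, a (x j)| ≤ n * C ^ n := by
  calc |∑ i, a' (x i) * ∏ j ∈ univ.erase i, a (x j)| ≤ ∑ i, |a' (x i) * ∏ j ∈ univ.erase i, a (x j)| :=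
        Finset.abs_sum_le_sum_abs _ _
    _ ≤ ∑ _i : Fin n, C ^ n := by
        refine Finset.sum_le_sum fun i _ => ?_
        rw [abs_mul, Finset.abs_prod]
        have hcard : (univ.erase i).card = n - 1 := by
          rw [Finset.card_erase_of_mem (mem_univ i), Finset.card_univ, Fintype.card_fin]
        have hn : n = (n - 1) + 1 := by
          have : 0 < n := Fin.pos i
          omega
        calc |a' (x i)| * ∏ j ∈ univ.erase i, |a (x j)| ≤ C * ∏ _j ∈ univ.erase i, C :=
              mul_le_mul (ha' _) (Finset.prod_le_prod (fun j _ => abs_nonneg _) fun j _ => ha _)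
                (Finset.prod_nonneg fun j _ => abs_nonneg _) hC
          _ = C ^ n := by
              rw [Finset.prod_const, hcard]
              conv_rhs => rw [hn, pow_succ]
              ring
    _ = n * C ^ n := by simp

/-- **Differentiation under the integral sign for the canonical weights.** Along a path of
activities `a κ`, differentiable in `κ` on a ball around `κ₀` with `a κ`, `a' κ` continuous on `𝕋³`
and uniformly bounded there, for every bounded measurable `F`:
`d/dκ|_{κ₀} ∫ F(x) posWeight(a_κ)(x) dx = ∫ F(x) 𝟙_{no overlap}(x) ∑ᵢ a'_{κ₀}(xᵢ) ∏_{j≠i} a_{κ₀}(xⱼ) dx`.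
[folklore] -/
theorem hasDerivAt_integral_mul_posWeight {a a' : ℝ → T3 → ℝ} {κ₀ r C : ℝ} (hr : 0 < r) (hC : 0 ≤ C)
    (ha_cont : ∀ κ ∈ ball κ₀ r, Continuous (a κ)) (ha'_cont : ∀ κ ∈ ball κ₀ r, Continuous (a' κ))
    (hderiv : ∀ κ ∈ ball κ₀ r, ∀ y, HasDerivAt (fun κ => a κ y) (a' κ y) κ)
    (hbd : ∀ κ ∈ ball κ₀ r, ∀ y, |a κ y| ≤ C) (hbd' : ∀ κ ∈ ball κ₀ r, ∀ y, |a' κ y| ≤ C)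
    {F : (Fin n → T3) → ℝ} (hFm : Measurable F) {K : ℝ} (hFK : ∀ x, |F x| ≤ K) (ε : ℝ) :
    HasDerivAt (fun κ => ∫ x, F x * posWeight (a κ) ε n x)
      (∫ x, F x * (posDomain ε n).indicator
        (fun x => ∑ i, a' κ₀ (x i) * ∏ j ∈ univ.erase i, a κ₀ (x j)) x) κ₀ := by
  have hK : 0 ≤ K := (abs_nonneg _).trans (hFK fun _ => 0)
  have hball : ball κ₀ r ∈ 𝓝 κ₀ := ball_mem_nhds κ₀ hr
  have hκ₀ : κ₀ ∈ ball κ₀ r := mem_ball_self hr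
  -- measurability of the derivative integrand
  have hDm : ∀ κ ∈ ball κ₀ r, Measurable fun x : Fin n → T3 => (posDomain ε n).indicator
      (fun x => ∑ i, a' κ (x i) * ∏ j ∈ univ.erase i, a κ (x j)) x := by
    intro κ hκ
    refine (Finset.measurable_sum _ fun i _ => ?_).indicator (measurableSet_posDomain ε n)
    exact ((ha'_cont κ hκ).measurable.comp (measurable_pi_apply i)).mul
      (Finset.measurable_prod _ fun j _ => (ha_cont κ hκ).measurable.comp (measurable_pi_apply j))
  have key := hasDerivAt_integral_of_dominated_loc_of_deriv_le (𝕜 := ℝ)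
    (μ := (volume : Measure (Fin n → T3))) (x₀ := κ₀) (s := ball κ₀ r)
    (F := fun κ x => F x * posWeight (a κ) ε n x)
    (F' := fun κ x => F x * (posDomain ε n).indicator
      (fun x => ∑ i, a' κ (x i) * ∏ j ∈ univ.erase i, a κ (x j)) x)
    (bound := fun _ => K * (n * C ^ n)) hball ?_ ?_ ?_ ?_ (integrable_const _) ?_
  · exact key.2
  · -- measurability of `F · posWeight(a κ)` near `κ₀`
    filter_upwards [hball] with κ hκ
    exact (hFm.mul (measurable_posWeight (ha_cont κ hκ) ε n)).aestronglyMeasurable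
  · -- integrability at `κ₀`
    refine Integrable.mono' (integrable_const (K * C ^ n))
      (hFm.mul (measurable_posWeight (ha_cont κ₀ hκ₀) ε n)).aestronglyMeasurable
      (ae_of_all _ fun x => ?_)
    rw [Real.norm_eq_abs, abs_mul]
    refine mul_le_mul (hFK x) ?_ (abs_nonneg _) hK
    rw [posWeight]
    by_cases hx : x ∈ posDomain ε n
    · rw [Set.indicator_of_mem hx]
      calc |∏ i, a κ₀ (x i)| = ∏ i, |a κ₀ (x i)| := Finset.abs_prod _ _
        _ ≤ ∏ _i : Fin n, C := Finset.prod_le_prod (fun i _ => abs_nonneg _) fun i _ => hbd κ₀ hκ₀ _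
        _ = C ^ n := by simp
    · rw [Set.indicator_of_notMem hx, abs_zero]; positivity
  · exact (hFm.mul (hDm κ₀ hκ₀)).aestronglyMeasurable
  · -- the uniform bound on the derivative integrand
    refine ae_of_all _ fun x κ hκ => ?_
    rw [Real.norm_eq_abs, abs_mul]
    refine mul_le_mul (hFK x) ?_ (abs_nonneg _) hK
    by_cases hx : x ∈ posDomain ε n
    · rw [Set.indicator_of_mem hx]
      exact abs_sum_mul_prod_erase_le hC (hbd κ hκ) (hbd' κ hκ) x
    · rw [Set.indicator_of_notMem hx, abs_zero]; positivity
  · -- pointwise differentiability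
    refine ae_of_all _ fun x κ hκ => ?_
    exact (hasDerivAt_posWeight ε x (hderiv κ hκ)).const_mul (F x)

/-- The score form of the derivative of the weight for positive activities:
`𝟙_{no overlap} ∑ᵢ a'(xᵢ) ∏_{j≠i} a(xⱼ) = (∑ᵢ a'(xᵢ)/a(xᵢ)) · posWeight a` pointwise. [folklore] -/
theorem indicator_sum_mul_prod_erase_eq {a a' : T3 → ℝ} (ha : ∀ y, 0 < a y) (ε : ℝ) (x : Fin n → T3) :
    (posDomain ε n).indicator (fun x => ∑ i, a' (x i) * ∏ j ∈ univ.erase i, a (x j)) x =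
      (∑ i, a' (x i) / a (x i)) * posWeight a ε n x := by
  rw [posWeight]
  by_cases hx : x ∈ posDomain ε n
  · rw [Set.indicator_of_mem hx, Set.indicator_of_mem hx, Finset.sum_mul]
    refine Finset.sum_congr rfl fun i _ => ?_
    rw [← Finset.mul_prod_erase univ (fun j => a (x j)) (mem_univ i)]
    have hai := (ha (x i)).ne'
    field_simp
  · rw [Set.indicator_of_notMem hx, Set.indicator_of_notMem hx, mul_zero]

/-- **Differentiation under the integral sign, score form**: for positive activities at `κ₀`,
`d/dκ|_{κ₀} ∫ F posWeight(a_κ) = ∫ F · (∑ᵢ a'_{κ₀}(xᵢ)/a_{κ₀}(xᵢ)) · posWeight(a_{κ₀})`. [folklore] -/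
theorem hasDerivAt_integral_mul_posWeight' {a a' : ℝ → T3 → ℝ} {κ₀ r C : ℝ} (hr : 0 < r) (hC : 0 ≤ C)
    (ha_cont : ∀ κ ∈ ball κ₀ r, Continuous (a κ)) (ha'_cont : ∀ κ ∈ ball κ₀ r, Continuous (a' κ))
    (hderiv : ∀ κ ∈ ball κ₀ r, ∀ y, HasDerivAt (fun κ => a κ y) (a' κ y) κ)
    (hbd : ∀ κ ∈ ball κ₀ r, ∀ y, |a κ y| ≤ C) (hbd' : ∀ κ ∈ ball κ₀ r, ∀ y, |a' κ y| ≤ C)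
    (hpos : ∀ y, 0 < a κ₀ y)
    {F : (Fin n → T3) → ℝ} (hFm : Measurable F) {K : ℝ} (hFK : ∀ x, |F x| ≤ K) (ε : ℝ) :
    HasDerivAt (fun κ => ∫ x, F x * posWeight (a κ) ε n x)
      (∫ x, F x * (∑ i, a' κ₀ (x i) / a κ₀ (x i)) * posWeight (a κ₀) ε n x) κ₀ := by
  have h := hasDerivAt_integral_mul_posWeight hr hC ha_cont ha'_cont hderiv hbd hbd' hFm hFK ε
  refine h.congr_deriv (integral_congr_ae (ae_of_all _ fun x => ?_))
  simp only
  rw [indicator_sum_mul_prod_erase_eq hpos ε x, mul_assoc]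

/-! ### Expectations under `posGibbsMeasure` and the score identity -/

variable {a₀ : T3 → ℝ}

/-- **Expectations under the configurational canonical Gibbs measure** are normalised weighted
integrals: `∫ F d(posGibbsMeasure a₀ ε n) = Z⁻¹ ∫ F · posWeight a₀` (`a₀ ≥ 0` continuous). [folklore] -/
theorem integral_posGibbsMeasure_eq (ha : Continuous a₀) (ha0 : ∀ x, 0 ≤ a₀ x) (ε : ℝ) (n : ℕ)
    (F : (Fin n → T3) → ℝ) :
    ∫ x, F x ∂posGibbsMeasure a₀ ε n = (posPartition a₀ ε n)⁻¹ * ∫ x, F x * posWeight a₀ ε n x := by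
  have hZ0 : 0 ≤ (posPartition a₀ ε n)⁻¹ := inv_nonneg.2 (posPartition_nonneg ha0 ε n)
  rw [posGibbsMeasure, integral_withDensity_eq_integral_toReal_smul]
  · rw [← integral_const_mul]
    refine integral_congr_ae (ae_of_all _ fun x => ?_)
    dsimp only
    rw [ENNReal.toReal_ofReal (mul_nonneg hZ0 (posWeight_nonneg ha0 ε x)), smul_eq_mul]
    ring
  · exact (measurable_const.mul (measurable_posWeight ha ε n)).ennreal_ofReal
  · exact ae_of_all _ fun _ => ENNReal.ofReal_lt_top

/-- **The finite-`n` score identity** for the configurational canonical Gibbs measure along a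
differentiable path of positive activities `a κ` (with `Z(a_{κ₀}) > 0`): for bounded measurable `F`,
`d/dκ|_{κ₀} E_{a_κ}[F] = E_{a_{κ₀}}[F S] - E_{a_{κ₀}}[F] E_{a_{κ₀}}[S]`, `S = ∑ᵢ a'_{κ₀}(xᵢ)/a_{κ₀}(xᵢ)`
the score — the covariance of `F` with the score (likelihood-ratio / exponential-family calculus:
quotient rule on `(∫ F w_κ)/(∫ w_κ)` with `hasDerivAt_integral_mul_posWeight'`). [folklore] -/
theorem hasDerivAt_integral_posGibbsMeasure {a a' : ℝ → T3 → ℝ} {κ₀ r C : ℝ} (hr : 0 < r) (hC : 0 ≤ C)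
    (ha_cont : ∀ κ ∈ ball κ₀ r, Continuous (a κ)) (ha'_cont : ∀ κ ∈ ball κ₀ r, Continuous (a' κ))
    (hderiv : ∀ κ ∈ ball κ₀ r, ∀ y, HasDerivAt (fun κ => a κ y) (a' κ y) κ)
    (hbd : ∀ κ ∈ ball κ₀ r, ∀ y, |a κ y| ≤ C) (hbd' : ∀ κ ∈ ball κ₀ r, ∀ y, |a' κ y| ≤ C)
    (hnn : ∀ κ ∈ ball κ₀ r, ∀ y, 0 ≤ a κ y) (hpos : ∀ y, 0 < a κ₀ y) {ε : ℝ}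
    (hZ : 0 < posPartition (a κ₀) ε n)
    {F : (Fin n → T3) → ℝ} (hFm : Measurable F) {K : ℝ} (hFK : ∀ x, |F x| ≤ K) :
    HasDerivAt (fun κ => ∫ x, F x ∂posGibbsMeasure (a κ) ε n)
      ((∫ x, F x * ∑ i, a' κ₀ (x i) / a κ₀ (x i) ∂posGibbsMeasure (a κ₀) ε n) -
        (∫ x, F x ∂posGibbsMeasure (a κ₀) ε n) *
          ∫ x, ∑ i, a' κ₀ (x i) / a κ₀ (x i) ∂posGibbsMeasure (a κ₀) ε n) κ₀ := by
  have hball : ball κ₀ r ∈ 𝓝 κ₀ := ball_mem_nhds κ₀ hr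
  have hκ₀ : κ₀ ∈ ball κ₀ r := mem_ball_self hr
  -- the numerator and the partition function as functions of `κ`
  have hN := hasDerivAt_integral_mul_posWeight' hr hC ha_cont ha'_cont hderiv hbd hbd' hpos hFm hFK ε
  have hZ' : HasDerivAt (fun κ => posPartition (a κ) ε n)
      (∫ x, (1 : ℝ) * (∑ i, a' κ₀ (x i) / a κ₀ (x i)) * posWeight (a κ₀) ε n x) κ₀ := by
    have h := hasDerivAt_integral_mul_posWeight' (n := n) hr hC ha_cont ha'_cont hderiv hbd hbd' hpos
      (F := fun _ => (1 : ℝ)) measurable_const (K := 1) (fun _ => by simp) ε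
    refine h.congr_of_eventuallyEq (Eventually.of_forall fun κ => ?_)
    simp [posPartition]
  -- the quotient
  have hquot := hN.div hZ' hZ.ne'
  have hfun : (fun κ => ∫ x, F x ∂posGibbsMeasure (a κ) ε n) =ᶠ[𝓝 κ₀]
      fun κ => (∫ x, F x * posWeight (a κ) ε n x) / posPartition (a κ) ε n := by
    filter_upwards [hball] with κ hκ
    rw [integral_posGibbsMeasure_eq (ha_cont κ hκ) (hnn κ hκ) ε n F, div_eq_inv_mul]
  refine (hquot.congr_of_eventuallyEq hfun).congr_deriv ?_
  -- identification of the derivative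
  rw [integral_posGibbsMeasure_eq (ha_cont κ₀ hκ₀) (hnn κ₀ hκ₀) ε n,
    integral_posGibbsMeasure_eq (ha_cont κ₀ hκ₀) (hnn κ₀ hκ₀) ε n F,
    integral_posGibbsMeasure_eq (ha_cont κ₀ hκ₀) (hnn κ₀ hκ₀) ε n]
  simp only [one_mul]
  have hZne := hZ.ne'
  field_simp

end Summit.AtomisticToContinuum.HydrodynamicLimit.Theorems

end
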